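import Literature.NumberTheory.LFunctions.PretentiousZeta
import Literature.NumberTheory.LFunctions.AFEHarmonicSums
import Mathlib.NumberTheory.SmoothNumbers
import Mathlib.NumberTheory.EulerProduct.Basic
import Mathlib.NumberTheory.LSeries.Convolution
import Mathlib.NumberTheory.LSeries.Dirichlet
import HarnessLib

/-!
# Halász's theorem, I: the Dirichlet series of the `x`-smooth truncation

For a completely multiplicative `g : ℕ → ℂ` with `|g| ≤ 1` and `N = ⌊x⌋`, let
`g̃ = g · 1_{(N+1)-smooth}` (`smoothCut g N`).  Its Dirichlet series
`G(s) = ∑ g̃(n) n^{-s} = ∏_{p ≤ N} (1 - g(p) p^{-s})^{-1}` converges absolutely for `Re s > 0`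
(Euler product over finitely many primes, via `EulerProduct`), and on `Re s ≥ 1` satisfies
`|G(s)| ≤ exp(∑_{p ≤ N} Re(g(p) p^{-s}) + 1)`.  Consequences used in Halász's theorem
(Granville–Soundararajan 2003, §§3b–4, the function `F(s)` there):
* on the `1`-line, `|G(1+iy)| ≤ e⁵ log x · e^{-𝔻(g, n^{iy}; x)²}` (pretentious distance,
  `Literature.NumberTheory.Sieve.pretentiousDistSq`), by Mertens' bound `∑_{p ≤ x} 1/p ≤ log log x + 4`;
* on `Re s = 1 + α`, `|G| ≤ e^{10} min(log x, 1/α)` (Granville–Soundararajan (4.1));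
* `∑ |g̃(n)|/n ≤ e⁵ log x`, `∑ g̃-weights at 1+α ≤ e^{10}/α`;
* the factorisation `D = P · G` of the series of `g̃ log` (`mulLog`) through the series of
  `g̃ Λ` (`mulVM`), i.e. `-G'/G = ∑ g̃(n)Λ(n) n^{-s}` in coefficient form
  (`LSeries.convolution`), and the Rankin bound `∑ n |g̃(n) log n / n^{1+α}|² ≤ 4e^{10}/α³`;
* `∑_{p ≤ M} 1/(p log p) ≤ 13` and the averaging lemma
  `∃ t ∈ [0,1], 𝔻(g, n^{it}; x)² ≤ log log x + 30` (so that `min_{|t| ≤ T} 𝔻² ≤ log log x + O(1)`).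

## References
- [GranvilleSoundararajan2003] A. Granville, K. Soundararajan, *Decay of mean values of
  multiplicative functions*, Canad. J. Math. 55 (2003), §3b and §4 ((4.1)).
-/

noncomputable section

open Finset Real Complex
open scoped ComplexConjugate

namespace Literature.NumberTheory.LFunctions

namespace Halasz

/-! ### The smooth truncation `g̃ = g · 1_{(N+1)-smooth}` -/

open scoped Classical in
/-- `g̃(n) = g(n)` if all prime factors of `n` are `≤ N` (and `n ≠ 0`), else `0`. [folklore] -/
def smoothCut (g : ℕ → ℂ) (N : ℕ) : ℕ → ℂ := (Nat.smoothNumbers (N + 1)).indicator g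

variable {g : ℕ → ℂ} {N : ℕ}

/-- `g̃(n) = g(n)` for `(N+1)`-smooth `n`. [folklore] -/
theorem smoothCut_of_mem {n : ℕ} (h : n ∈ Nat.smoothNumbers (N + 1)) : smoothCut g N n = g n := by
  classical
  exact Set.indicator_of_mem h g

/-- `g̃(n) = 0` if `n` is not `(N+1)`-smooth. [folklore] -/
theorem smoothCut_of_not_mem {n : ℕ} (h : n ∉ Nat.smoothNumbers (N + 1)) : smoothCut g N n = 0 := by
  classical
  exact Set.indicator_of_notMem h g

/-- `g̃(0) = 0`. [folklore] -/
theorem smoothCut_zero : smoothCut g N 0 = 0 :=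
  smoothCut_of_not_mem (fun h => Nat.ne_zero_of_mem_smoothNumbers h rfl)

/-- `g̃(n) = g(n)` for `1 ≤ n ≤ N`. [folklore] -/
theorem smoothCut_eq_self {n : ℕ} (hn1 : 1 ≤ n) (hnN : n ≤ N) : smoothCut g N n = g n :=
  smoothCut_of_mem (Nat.mem_smoothNumbers_of_lt hn1 (Nat.lt_succ_of_le hnN))

/-- `1` is `M`-smooth. [folklore] -/
theorem one_mem_smoothNumbers (M : ℕ) : 1 ∈ Nat.smoothNumbers M := by
  rw [Nat.mem_smoothNumbers]; simp

/-- `g̃(1) = 1` when `g(1) = 1`. [folklore] -/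
theorem smoothCut_one (hg1 : g 1 = 1) : smoothCut g N 1 = 1 := by
  rw [smoothCut_of_mem (one_mem_smoothNumbers _), hg1]

/-- `|g̃(n)| ≤ 1` for `1`-bounded `g`. [folklore] -/
theorem norm_smoothCut_le (hgb : ∀ n, ‖g n‖ ≤ 1) (n : ℕ) : ‖smoothCut g N n‖ ≤ 1 := by
  by_cases h : n ∈ Nat.smoothNumbers (N + 1)
  · rw [smoothCut_of_mem h]; exact hgb n
  · rw [smoothCut_of_not_mem h, norm_zero]; exact zero_le_one

/-- `|g̃(n)| ≤ |g(n)|`. [folklore] -/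
theorem norm_smoothCut_le_norm (n : ℕ) : ‖smoothCut g N n‖ ≤ ‖g n‖ := by
  by_cases h : n ∈ Nat.smoothNumbers (N + 1)
  · rw [smoothCut_of_mem h]
  · rw [smoothCut_of_not_mem h, norm_zero]; exact norm_nonneg _

/-- `g̃` is completely multiplicative when `g` is. [folklore] -/
theorem smoothCut_mul (hg : ∀ m n, g (m * n) = g m * g n) (m n : ℕ) :
    smoothCut g N (m * n) = smoothCut g N m * smoothCut g N n := by
  by_cases hm : m ∈ Nat.smoothNumbers (N + 1)
  · by_cases hn : n ∈ Nat.smoothNumbers (N + 1)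
    · rw [smoothCut_of_mem hm, smoothCut_of_mem hn, smoothCut_of_mem (Nat.mul_mem_smoothNumbers hm hn), hg]
    · have : m * n ∉ Nat.smoothNumbers (N + 1) := fun h =>
        hn (Nat.mem_smoothNumbers_of_dvd h (Dvd.intro_left m rfl))
      rw [smoothCut_of_not_mem hn, smoothCut_of_not_mem this, mul_zero]
  · have : m * n ∉ Nat.smoothNumbers (N + 1) := fun h =>
      hm (Nat.mem_smoothNumbers_of_dvd h (Dvd.intro n rfl))
    rw [smoothCut_of_not_mem hm, smoothCut_of_not_mem this, zero_mul]

/-! ### The Euler product of `G(s) = ∑ g̃(n) n^{-s}` -/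

/-- The completely multiplicative function `n ↦ g̃(n) n^{-s}` as a monoid homomorphism. [folklore] -/
def smoothHom (g : ℕ → ℂ) (N : ℕ) (hg : ∀ m n, g (m * n) = g m * g n) (hg1 : g 1 = 1) (s : ℂ) :
    ℕ →* ℂ where
  toFun n := smoothCut g N n * (n : ℂ) ^ (-s)
  map_one' := by simp [smoothCut_one hg1]
  map_mul' m n := by
    rw [Nat.cast_mul, Complex.natCast_mul_natCast_cpow, smoothCut_mul hg]
    ring

/-- Unfolding of `smoothHom`. [folklore] -/
theorem smoothHom_apply (hg : ∀ m n, g (m * n) = g m * g n) (hg1 : g 1 = 1) (s : ℂ) (n : ℕ) :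
    smoothHom g N hg hg1 s n = smoothCut g N n * (n : ℂ) ^ (-s) := rfl

/-- The `L`-series terms of `g̃` are the indicator of the smooth numbers applied to `g̃(n) n^{-s}`. [folklore] -/
theorem term_smoothCut_eq_indicator (s : ℂ) :
    LSeries.term (smoothCut g N) s =
      (Nat.smoothNumbers (N + 1)).indicator (fun n : ℕ => smoothCut g N n * (n : ℂ) ^ (-s)) := by
  funext n
  by_cases h : n ∈ Nat.smoothNumbers (N + 1)
  · rw [Set.indicator_of_mem h, LSeries.term_of_ne_zero (Nat.ne_zero_of_mem_smoothNumbers h),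
      Complex.cpow_neg, div_eq_mul_inv]
  · rw [Set.indicator_of_notMem h]
    rcases Nat.eq_zero_or_pos n with rfl | hn
    · exact LSeries.term_zero _ _
    · rw [LSeries.term_of_ne_zero hn.ne', smoothCut_of_not_mem h, zero_div]

/-- **Euler product for the smooth truncation**: for `Re s > 0`, `∑ g̃(n) n^{-s}` converges
absolutely and equals `∏_{p ≤ N} (1 - g(p) p^{-s})⁻¹`. [folklore] -/
theorem hasSum_term_smoothCut (hg : ∀ m n, g (m * n) = g m * g n) (hg1 : g 1 = 1)
    (hgb : ∀ n, ‖g n‖ ≤ 1) {s : ℂ} (hs : 0 < s.re) :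
    LSeriesSummable (smoothCut g N) s ∧
      HasSum (LSeries.term (smoothCut g N) s)
        (∏ p ∈ Nat.primesBelow (N + 1), (1 - g p * (p : ℂ) ^ (-s))⁻¹) := by
  have hlt : ∀ {p : ℕ}, p.Prime → ‖smoothHom g N hg hg1 s p‖ < 1 := by
    intro p hp
    rw [smoothHom_apply, norm_mul, Complex.norm_natCast_cpow_of_pos hp.pos, Complex.neg_re]
    have h1 : ‖smoothCut g N p‖ ≤ 1 := norm_smoothCut_le hgb p
    have h2 : (p : ℝ) ^ (-s.re) < 1 :=
      Real.rpow_lt_one_of_one_lt_of_neg (by exact_mod_cast hp.one_lt) (by linarith)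
    have h3 : 0 ≤ (p : ℝ) ^ (-s.re) := by positivity
    calc ‖smoothCut g N p‖ * (p : ℝ) ^ (-s.re) ≤ 1 * (p : ℝ) ^ (-s.re) := by gcongr
      _ < 1 := by rw [one_mul]; exact h2
  obtain ⟨hsum, hhas⟩ :=
    EulerProduct.summable_and_hasSum_smoothNumbers_prod_primesBelow_geometric (f := smoothHom g N hg hg1 s)
      hlt (N + 1)
  have hprod : ∏ p ∈ Nat.primesBelow (N + 1), (1 - smoothHom g N hg hg1 s p)⁻¹ =
      ∏ p ∈ Nat.primesBelow (N + 1), (1 - g p * (p : ℂ) ^ (-s))⁻¹ := by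
    refine Finset.prod_congr rfl fun p hp => ?_
    rw [Nat.mem_primesBelow] at hp
    rw [smoothHom_apply, smoothCut_eq_self hp.2.one_lt.le (Nat.lt_succ_iff.mp hp.1)]
  have hhas' : HasSum (LSeries.term (smoothCut g N) s)
      (∏ p ∈ Nat.primesBelow (N + 1), (1 - g p * (p : ℂ) ^ (-s))⁻¹) := by
    rw [← hprod, term_smoothCut_eq_indicator]
    exact hasSum_subtype_iff_indicator.mp hhas
  exact ⟨hhas'.summable, hhas'⟩

/-- The Dirichlet series of `g̃` converges absolutely for `Re s > 0`. [folklore] -/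
theorem LSeriesSummable_smoothCut (hg : ∀ m n, g (m * n) = g m * g n) (hg1 : g 1 = 1)
    (hgb : ∀ n, ‖g n‖ ≤ 1) {s : ℂ} (hs : 0 < s.re) : LSeriesSummable (smoothCut g N) s :=
  (hasSum_term_smoothCut hg hg1 hgb hs).1

/-- `G(s) = ∏_{p ≤ N} (1 - g(p)p^{-s})⁻¹` for `Re s > 0` (finite Euler product). [folklore] -/
theorem LSeries_smoothCut_eq_prod (hg : ∀ m n, g (m * n) = g m * g n) (hg1 : g 1 = 1)
    (hgb : ∀ n, ‖g n‖ ≤ 1) {s : ℂ} (hs : 0 < s.re) :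
    LSeries (smoothCut g N) s = ∏ p ∈ Nat.primesBelow (N + 1), (1 - g p * (p : ℂ) ^ (-s))⁻¹ :=
  (hasSum_term_smoothCut hg hg1 hgb hs).2.tsum_eq

/-! ### Bounding the Euler product -/

/-- `‖(1 - z)⁻¹‖ ≤ exp(Re z + ‖z‖²)` for `‖z‖ ≤ 1/2`. [folklore] -/
theorem norm_inv_one_sub_le {z : ℂ} (hz : ‖z‖ ≤ 1 / 2) :
    ‖(1 - z)⁻¹‖ ≤ Real.exp (z.re + ‖z‖ ^ 2) := by
  have h1 : 1 - z ≠ 0 := by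
    intro h
    have : ‖z‖ = 1 := by rw [show z = 1 by linear_combination -h]; simp
    linarith
  have heq : (1 - z)⁻¹ = Complex.exp (-Complex.log (1 - z)) := by
    rw [Complex.exp_neg, Complex.exp_log h1]
  rw [heq, Complex.norm_exp]
  apply Real.exp_le_exp.mpr
  have h2 := norm_neg_log_one_sub_sub_le hz
  have h3 : (-Complex.log (1 - z)).re = z.re + (-Complex.log (1 - z) - z).re := by
    simp only [Complex.neg_re, Complex.sub_re]; ring
  rw [h3]
  gcongr
  exact (Complex.re_le_norm _).trans h2

/-- `∑_{p ≤ N prime} 1/p² ≤ 1`. [folklore] -/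
theorem sum_primesBelow_inv_sq_le_one (M : ℕ) :
    ∑ p ∈ Nat.primesBelow M, (1 : ℝ) / (p : ℝ) ^ 2 ≤ 1 := by
  have hsub : Nat.primesBelow M ⊆ Finset.Ioc 1 M := by
    intro p hp
    rw [Nat.mem_primesBelow] at hp
    rw [Finset.mem_Ioc]
    exact ⟨hp.2.one_lt, hp.1.le⟩
  calc ∑ p ∈ Nat.primesBelow M, (1 : ℝ) / (p : ℝ) ^ 2 ≤ ∑ p ∈ Finset.Ioc 1 M, (1 : ℝ) / (p : ℝ) ^ 2 :=
        Finset.sum_le_sum_of_subset_of_nonneg hsub fun p _ _ => by positivity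
    _ ≤ 1 / (1 : ℕ) := Literature.NumberTheory.LFunctions.AFE.sum_Ioc_inv_sq_le le_rfl M
    _ = 1 := by norm_num

/-- **Norm of the Euler product**: for `Re s ≥ 1`,
`‖G(s)‖ ≤ exp(∑_{p ≤ N} Re(g(p) p^{-s}) + 1)`. [folklore] -/
theorem norm_LSeries_smoothCut_le (hg : ∀ m n, g (m * n) = g m * g n) (hg1 : g 1 = 1)
    (hgb : ∀ n, ‖g n‖ ≤ 1) {s : ℂ} (hs : 1 ≤ s.re) :
    ‖LSeries (smoothCut g N) s‖ ≤
      Real.exp (∑ p ∈ Nat.primesBelow (N + 1), (g p * (p : ℂ) ^ (-s)).re + 1) := by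
  rw [LSeries_smoothCut_eq_prod hg hg1 hgb (by linarith), norm_prod]
  have hz : ∀ p ∈ Nat.primesBelow (N + 1), ‖g p * (p : ℂ) ^ (-s)‖ ≤ 1 / p := by
    intro p hp
    rw [Nat.mem_primesBelow] at hp
    rw [norm_mul, Complex.norm_natCast_cpow_of_pos hp.2.pos, Complex.neg_re]
    have h1 : (p : ℝ) ^ (-s.re) ≤ (p : ℝ) ^ (-1 : ℝ) :=
      Real.rpow_le_rpow_of_exponent_le (by exact_mod_cast hp.2.one_lt.le) (by linarith)
    rw [Real.rpow_neg_one] at h1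
    calc ‖g p‖ * (p : ℝ) ^ (-s.re) ≤ 1 * (p : ℝ)⁻¹ := by
          gcongr
          · exact hgb p
      _ = 1 / p := by ring
  have hz' : ∀ p ∈ Nat.primesBelow (N + 1), ‖g p * (p : ℂ) ^ (-s)‖ ≤ 1 / 2 := by
    intro p hp
    refine (hz p hp).trans ?_
    rw [Nat.mem_primesBelow] at hp
    have : (2 : ℝ) ≤ p := by exact_mod_cast hp.2.two_le
    exact one_div_le_one_div_of_le (by norm_num) this
  calc ∏ p ∈ Nat.primesBelow (N + 1), ‖(1 - g p * (p : ℂ) ^ (-s))⁻¹‖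
      ≤ ∏ p ∈ Nat.primesBelow (N + 1), Real.exp ((g p * (p : ℂ) ^ (-s)).re + ‖g p * (p : ℂ) ^ (-s)‖ ^ 2) :=
        Finset.prod_le_prod (fun p _ => norm_nonneg _) fun p hp => norm_inv_one_sub_le (hz' p hp)
    _ = Real.exp (∑ p ∈ Nat.primesBelow (N + 1), ((g p * (p : ℂ) ^ (-s)).re + ‖g p * (p : ℂ) ^ (-s)‖ ^ 2)) := by
        rw [Real.exp_sum]
    _ ≤ Real.exp (∑ p ∈ Nat.primesBelow (N + 1), (g p * (p : ℂ) ^ (-s)).re + 1) := by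
        apply Real.exp_le_exp.mpr
        rw [Finset.sum_add_distrib]
        gcongr
        refine le_trans (Finset.sum_le_sum fun p hp => ?_) (sum_primesBelow_inv_sq_le_one (N + 1))
        have h := hz p hp
        have h0 : 0 ≤ ‖g p * (p : ℂ) ^ (-s)‖ := norm_nonneg _
        calc ‖g p * (p : ℂ) ^ (-s)‖ ^ 2 ≤ (1 / p) ^ 2 := pow_le_pow_left₀ h0 h 2
          _ = 1 / (p : ℝ) ^ 2 := by ring

/-! ### The real parts on the lines `Re s = 1` and `Re s = 1 + α` -/

/-- `Re(g(p) p^{-1-iy}) = (1/p) Re(g(p) conj(p^{iy}))`. [folklore] -/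
theorem re_mul_cpow_neg_one_add (c : ℂ) {p : ℕ} (hp : 0 < p) (y : ℝ) :
    (c * (p : ℂ) ^ (-(1 + (y : ℂ) * I))).re =
      (c * conj ((p : ℂ) ^ ((y : ℂ) * I))).re / p := by
  have hp0 : (p : ℂ) ≠ 0 := by exact_mod_cast hp.ne'
  have hconj : conj ((p : ℂ) ^ ((y : ℂ) * I)) = (p : ℂ) ^ (-((y : ℂ) * I)) := by
    have harg : ((p : ℂ)).arg ≠ Real.pi := by
      rw [Complex.natCast_arg]; exact Real.pi_ne_zero.symm
    have h1 : conj (-((y : ℂ) * I)) = (y : ℂ) * I := by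
      simp [Complex.conj_ofReal]
    have h2 := Complex.cpow_conj (p : ℂ) (-((y : ℂ) * I)) harg
    rw [h1, Complex.conj_natCast] at h2
    rw [h2, Complex.conj_conj]
  rw [hconj, neg_add, Complex.cpow_add _ _ hp0, Complex.cpow_neg_one]
  have hinv : (((p : ℝ)⁻¹ : ℝ) : ℂ) = (p : ℂ)⁻¹ := by
    rw [Complex.ofReal_inv, Complex.ofReal_natCast]
  calc (c * ((p : ℂ)⁻¹ * (p : ℂ) ^ (-((y : ℂ) * I)))).re
      = ((((p : ℝ)⁻¹ : ℝ) : ℂ) * (c * (p : ℂ) ^ (-((y : ℂ) * I)))).re := by rw [hinv]; ring_nf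
    _ = (p : ℝ)⁻¹ * (c * (p : ℂ) ^ (-((y : ℂ) * I))).re := Complex.re_ofReal_mul _ _
    _ = _ := by rw [div_eq_inv_mul]

/-- On `Re s = 1`: `∑_{p ≤ N} Re(g(p) p^{-1-iy}) = ∑_{p ≤ N} 1/p - 𝔻(g, n^{iy}; x)²`
(`N = ⌊x⌋`). [folklore] -/
theorem sum_re_eq_sub_pretentiousDistSq (x y : ℝ) :
    ∑ p ∈ Nat.primesBelow (⌊x⌋₊ + 1), (g p * (p : ℂ) ^ (-(1 + (y : ℂ) * I))).re =
      ∑ p ∈ Nat.primesLE ⌊x⌋₊, (1 : ℝ) / p -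
        Sieve.pretentiousDistSq g (fun n : ℕ => (n : ℂ) ^ ((y : ℂ) * I)) x := by
  unfold Sieve.pretentiousDistSq
  rw [show Nat.primesBelow (⌊x⌋₊ + 1) = Nat.primesLE ⌊x⌋₊ from rfl, ← Finset.sum_sub_distrib]
  refine Finset.sum_congr rfl fun p hp => ?_
  rw [Nat.mem_primesLE] at hp
  rw [re_mul_cpow_neg_one_add _ hp.2.pos]
  field_simp
  ring

/-- On `Re s = 1 + α` (`α ≥ 0`): `Re(g(p) p^{-s}) ≤ p^{-1-α}`. [folklore] -/
theorem re_mul_cpow_le (hgb : ∀ n, ‖g n‖ ≤ 1) {p : ℕ} (hp : 0 < p) (s : ℂ) :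
    (g p * (p : ℂ) ^ (-s)).re ≤ (p : ℝ) ^ (-s.re) := by
  refine (Complex.re_le_norm _).trans ?_
  rw [norm_mul, Complex.norm_natCast_cpow_of_pos hp, Complex.neg_re]
  calc ‖g p‖ * (p : ℝ) ^ (-s.re) ≤ 1 * (p : ℝ) ^ (-s.re) := by gcongr; exact hgb p
    _ = _ := one_mul _

/-- Mertens, upper half: `∑_{p ≤ N} 1/p ≤ log log x + 4` for `3 ≤ x`, `N = ⌊x⌋`. [folklore] -/
theorem sum_primesLE_inv_le {x : ℝ} (hx : 3 ≤ x) :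
    ∑ p ∈ Nat.primesLE ⌊x⌋₊, (1 : ℝ) / p ≤ Real.log (Real.log x) + 4 := by
  have hN2 : 2 ≤ ⌊x⌋₊ := Nat.le_floor (by norm_num; linarith)
  have hN3 : (3 : ℝ) ≤ ⌊x⌋₊ := by exact_mod_cast Nat.le_floor hx
  have hNx : (⌊x⌋₊ : ℝ) ≤ x := Nat.floor_le (by linarith)
  refine (Literature.NumberTheory.LFunctions.MertensBound.sum_inv_prime_le ⌊x⌋₊ hN2).trans ?_
  gcongr
  · exact Real.log_pos (by linarith)

/-- The prime zeta bound: for `0 < α ≤ 1` and any `M`,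
`∑_{p ≤ M} p^{-1-α} ≤ log(1/α) + 9`. [folklore] -/
theorem sum_primesLE_rpow_le {α : ℝ} (hα : 0 < α) (hα1 : α ≤ 1) (M : ℕ) :
    ∑ p ∈ Nat.primesLE M, (p : ℝ) ^ (-(1 + α)) ≤ Real.log (1 / α) + 9 := by
  have hlog3 : 1 < Real.log 3 := Literature.NumberTheory.LFunctions.MertensBound.one_lt_log_three
  have hlog3pos : 0 < Real.log 3 := by linarith
  have hlog4 : Real.log 4 < 2 := by
    have h2 : Real.log 4 = 2 * Real.log 2 := by
      rw [show (4:ℝ) = 2^2 by norm_num, Real.log_pow]; ring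
    have := Real.log_two_lt_d9
    linarith
  -- main case: `β ≤ 1/log 3`, with `w = exp(1/β) ≥ 3` and `σ_w = 1 + β`
  have main : ∀ β : ℝ, 0 < β → β ≤ 1 / Real.log 3 →
      ∑ p ∈ Nat.primesLE M, (p : ℝ) ^ (-(1 + β)) ≤ Real.log (1 / β) + 8 := by
    intro β hβ hβs
    set w : ℝ := Real.exp (1 / β) with hw
    have h3β : Real.log 3 ≤ 1 / β := (le_one_div hβ hlog3pos).mp hβs
    have hw3 : 3 ≤ w := by
      calc (3 : ℝ) = Real.exp (Real.log 3) := (Real.exp_log (by norm_num)).symm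
        _ ≤ w := Real.exp_le_exp.mpr h3β
    have hσ : sigmaX w = 1 + β := by
      simp only [sigmaX, hw, Real.log_exp, one_div_one_div]
    have hsplit : ∑ p ∈ Nat.primesLE M, (p : ℝ) ^ (-(1 + β)) =
        ∑ p ∈ (Nat.primesLE M).filter (fun p : ℕ => w < p), (p : ℝ) ^ (-(1 + β)) +
          ∑ p ∈ (Nat.primesLE M).filter (fun p : ℕ => ¬ w < p), (p : ℝ) ^ (-(1 + β)) :=
      (Finset.sum_filter_add_sum_filter_not _ (fun p : ℕ => w < p) _).symm
    rw [hsplit]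
    have htail : ∑ p ∈ (Nat.primesLE M).filter (fun p : ℕ => w < p), (p : ℝ) ^ (-(1 + β)) ≤
        2 * Real.log 4 := by
      have := sum_tail_rpow_neg_sigmaX_le hw3 M
      rwa [hσ] at this
    have hhead : ∑ p ∈ (Nat.primesLE M).filter (fun p : ℕ => ¬ w < p), (p : ℝ) ^ (-(1 + β)) ≤
        Real.log (1 / β) + 4 := by
      have hsub : (Nat.primesLE M).filter (fun p : ℕ => ¬ w < p) ⊆ Nat.primesLE ⌊w⌋₊ := by
        intro p hp
        simp only [Finset.mem_filter, Nat.mem_primesLE, not_lt] at hp ⊢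
        exact ⟨Nat.le_floor hp.2, hp.1.2⟩
      calc ∑ p ∈ (Nat.primesLE M).filter (fun p : ℕ => ¬ w < p), (p : ℝ) ^ (-(1 + β))
          ≤ ∑ p ∈ Nat.primesLE ⌊w⌋₊, (p : ℝ) ^ (-(1 + β)) :=
            Finset.sum_le_sum_of_subset_of_nonneg hsub fun p _ _ => by positivity
        _ ≤ ∑ p ∈ Nat.primesLE ⌊w⌋₊, (1 : ℝ) / p := by
            refine Finset.sum_le_sum fun p hp => ?_
            rw [Nat.mem_primesLE] at hp
            have h1 : (p : ℝ) ^ (-(1 + β)) ≤ (p : ℝ) ^ (-1 : ℝ) :=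
              Real.rpow_le_rpow_of_exponent_le (by exact_mod_cast hp.2.one_lt.le) (by linarith)
            rwa [Real.rpow_neg_one, ← one_div] at h1
        _ ≤ Real.log (Real.log w) + 4 := sum_primesLE_inv_le hw3
        _ = Real.log (1 / β) + 4 := by simp only [hw, Real.log_exp]
    linarith
  rcases le_or_gt α (1 / Real.log 3) with hs | hs
  · linarith [main α hα hs]
  · have hβ : 0 < 1 / Real.log 3 := by positivity
    have h := main (1 / Real.log 3) hβ le_rfl
    have hmono : ∑ p ∈ Nat.primesLE M, (p : ℝ) ^ (-(1 + α)) ≤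
        ∑ p ∈ Nat.primesLE M, (p : ℝ) ^ (-(1 + 1 / Real.log 3)) := by
      refine Finset.sum_le_sum fun p hp => ?_
      rw [Nat.mem_primesLE] at hp
      exact Real.rpow_le_rpow_of_exponent_le (by exact_mod_cast hp.2.one_lt.le) (by linarith)
    have h1 : Real.log (1 / (1 / Real.log 3)) ≤ 1 := by
      rw [one_div_one_div]
      have := Real.log_le_sub_one_of_pos hlog3pos
      have h3 : Real.log 3 < 2 := by
        have := Real.log_lt_sub_one_of_pos (by norm_num : (0:ℝ) < 3) (by norm_num); linarith
      linarith
    have hlα : 0 ≤ Real.log (1 / α) := Real.log_nonneg (by rw [le_div_iff₀ hα]; linarith)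
    linarith


/-! ### Explicit bounds on `G` -/

variable {x : ℝ}

/-- On the `1`-line: `‖G(1+iy)‖ ≤ e⁵ · log x · e^{-𝔻(g, n^{iy}; x)²}` (`x ≥ 3`, `N = ⌊x⌋`). [folklore] -/
theorem norm_G_one_line_le (hg : ∀ m n, g (m * n) = g m * g n) (hg1 : g 1 = 1)
    (hgb : ∀ n, ‖g n‖ ≤ 1) (hx : 3 ≤ x) (y : ℝ) :
    ‖LSeries (smoothCut g ⌊x⌋₊) (1 + y * I)‖ ≤
      Real.exp 5 * Real.log x *
        Real.exp (-Sieve.pretentiousDistSq g (fun n : ℕ => (n : ℂ) ^ ((y : ℂ) * I)) x) := by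
  have hL : 0 < Real.log x := Real.log_pos (by linarith)
  have h := norm_LSeries_smoothCut_le (N := ⌊x⌋₊) hg hg1 hgb (s := 1 + y * I) (by simp)
  refine h.trans ?_
  have hs : (1 : ℂ) + y * I = 1 + (y : ℂ) * I := rfl
  have hneg : ∀ p : ℕ, (g p * (p : ℂ) ^ (-(1 + (y : ℂ) * I))).re = (g p * (p : ℂ) ^ (-((1 : ℂ) + y * I))).re :=
    fun p => rfl
  rw [show ∑ p ∈ Nat.primesBelow (⌊x⌋₊ + 1), (g p * (p : ℂ) ^ (-((1 : ℂ) + y * I))).re =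
      ∑ p ∈ Nat.primesLE ⌊x⌋₊, (1 : ℝ) / p - Sieve.pretentiousDistSq g (fun n : ℕ => (n : ℂ) ^ ((y : ℂ) * I)) x
      from sum_re_eq_sub_pretentiousDistSq x y]
  have hM := sum_primesLE_inv_le hx
  calc Real.exp (∑ p ∈ Nat.primesLE ⌊x⌋₊, (1 : ℝ) / p -
          Sieve.pretentiousDistSq g (fun n : ℕ => (n : ℂ) ^ ((y : ℂ) * I)) x + 1)
      ≤ Real.exp ((Real.log (Real.log x) + 4) -
          Sieve.pretentiousDistSq g (fun n : ℕ => (n : ℂ) ^ ((y : ℂ) * I)) x + 1) := by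
        apply Real.exp_le_exp.mpr; linarith
    _ = Real.exp 5 * Real.log x *
        Real.exp (-Sieve.pretentiousDistSq g (fun n : ℕ => (n : ℂ) ^ ((y : ℂ) * I)) x) := by
        rw [show Real.log (Real.log x) + 4 - Sieve.pretentiousDistSq g (fun n : ℕ => (n : ℂ) ^ ((y : ℂ) * I)) x + 1
            = 5 + Real.log (Real.log x) + -Sieve.pretentiousDistSq g (fun n : ℕ => (n : ℂ) ^ ((y : ℂ) * I)) x by ring,
          Real.exp_add, Real.exp_add, Real.exp_log hL]

/-- The real parts on `Re s = 1 + α`, summed: `≤ min(log log x + 4, log(1/α) + 9)`. [folklore] -/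
theorem sum_re_le_of_pos (hgb : ∀ n, ‖g n‖ ≤ 1) (hx : 3 ≤ x) {α : ℝ} (hα : 0 < α) (hα1 : α ≤ 1)
    (y : ℝ) :
    ∑ p ∈ Nat.primesBelow (⌊x⌋₊ + 1), (g p * (p : ℂ) ^ (-((1 : ℂ) + α + y * I))).re ≤
      min (Real.log (Real.log x) + 4) (Real.log (1 / α) + 9) := by
  have h1 : ∑ p ∈ Nat.primesBelow (⌊x⌋₊ + 1), (g p * (p : ℂ) ^ (-((1 : ℂ) + α + y * I))).re ≤
      ∑ p ∈ Nat.primesLE ⌊x⌋₊, (p : ℝ) ^ (-(1 + α)) := by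
    rw [show Nat.primesBelow (⌊x⌋₊ + 1) = Nat.primesLE ⌊x⌋₊ from rfl]
    refine Finset.sum_le_sum fun p hp => ?_
    rw [Nat.mem_primesLE] at hp
    have := re_mul_cpow_le hgb hp.2.pos ((1 : ℂ) + α + y * I)
    simpa using this
  refine h1.trans (le_min ?_ (sum_primesLE_rpow_le hα hα1 _))
  refine le_trans (Finset.sum_le_sum fun p hp => ?_) (sum_primesLE_inv_le hx)
  rw [Nat.mem_primesLE] at hp
  have h2 : (p : ℝ) ^ (-(1 + α)) ≤ (p : ℝ) ^ (-1 : ℝ) :=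
    Real.rpow_le_rpow_of_exponent_le (by exact_mod_cast hp.2.one_lt.le) (by linarith)
  rwa [Real.rpow_neg_one, ← one_div] at h2

/-- On `Re s = 1 + α` (`0 < α ≤ 1`): `‖G(1+α+iy)‖ ≤ e^{10} min(log x, 1/α)`. [folklore] -/
theorem norm_G_le_min (hg : ∀ m n, g (m * n) = g m * g n) (hg1 : g 1 = 1)
    (hgb : ∀ n, ‖g n‖ ≤ 1) (hx : 3 ≤ x) {α : ℝ} (hα : 0 < α) (hα1 : α ≤ 1) (y : ℝ) :
    ‖LSeries (smoothCut g ⌊x⌋₊) (1 + α + y * I)‖ ≤ Real.exp 10 * min (Real.log x) (1 / α) := by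
  have hL : 0 < Real.log x := Real.log_pos (by linarith)
  have h := norm_LSeries_smoothCut_le (N := ⌊x⌋₊) hg hg1 hgb (s := 1 + α + y * I)
    (by simp; linarith)
  refine h.trans ?_
  have hs := sum_re_le_of_pos (g := g) hgb hx hα hα1 y
  rcases le_total (Real.log x) (1 / α) with hmin | hmin
  · rw [min_eq_left hmin]
    calc Real.exp (∑ p ∈ Nat.primesBelow (⌊x⌋₊ + 1), (g p * (p : ℂ) ^ (-((1 : ℂ) + α + y * I))).re + 1)
        ≤ Real.exp ((Real.log (Real.log x) + 4) + 1) := by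
          apply Real.exp_le_exp.mpr; linarith [min_le_left (Real.log (Real.log x) + 4) (Real.log (1 / α) + 9)]
      _ = Real.exp 5 * Real.log x := by
          rw [show Real.log (Real.log x) + 4 + 1 = 5 + Real.log (Real.log x) by ring, Real.exp_add, Real.exp_log hL]
      _ ≤ Real.exp 10 * Real.log x := by gcongr; norm_num
  · rw [min_eq_right hmin]
    calc Real.exp (∑ p ∈ Nat.primesBelow (⌊x⌋₊ + 1), (g p * (p : ℂ) ^ (-((1 : ℂ) + α + y * I))).re + 1)
        ≤ Real.exp ((Real.log (1 / α) + 9) + 1) := by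
          apply Real.exp_le_exp.mpr; linarith [min_le_right (Real.log (Real.log x) + 4) (Real.log (1 / α) + 9)]
      _ = Real.exp 10 * (1 / α) := by
          rw [show Real.log (1 / α) + 9 + 1 = 10 + Real.log (1 / α) by ring, Real.exp_add,
            Real.exp_log (by positivity)]

/-! ### The majorant `𝟙̃` and `ℓ¹` bounds -/

/-- The real indicator of the smooth numbers, weighted: `z_σ(n) = n^{-σ} 1[n smooth]`. [folklore] -/
def smoothWeight (N : ℕ) (σ : ℝ) (n : ℕ) : ℝ :=
  if n ∈ Nat.smoothNumbers (N + 1) then ((n : ℝ) ^ σ)⁻¹ else 0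

/-- The majorant weights are nonnegative. [folklore] -/
theorem smoothWeight_nonneg (σ : ℝ) (n : ℕ) : 0 ≤ smoothWeight N σ n := by
  unfold smoothWeight; split_ifs <;> positivity

/-- For `g ≡ 1` the `L`-series term at real `σ` is the weight `smoothWeight N σ n`. [folklore] -/
theorem term_smoothCut_one_eq (σ : ℝ) (n : ℕ) :
    LSeries.term (smoothCut (fun _ => (1 : ℂ)) N) (σ : ℂ) n = (smoothWeight N σ n : ℂ) := by
  unfold smoothWeight
  by_cases h : n ∈ Nat.smoothNumbers (N + 1)
  · have hn := Nat.ne_zero_of_mem_smoothNumbers h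
    rw [if_pos h, LSeries.term_of_ne_zero hn, smoothCut_of_mem h, one_div,
      show (n : ℂ) = ((n : ℝ) : ℂ) by simp, ← Complex.ofReal_cpow (Nat.cast_nonneg n)]
    push_cast; rfl
  · rw [if_neg h]
    rcases Nat.eq_zero_or_pos n with rfl | hn
    · simp
    · rw [LSeries.term_of_ne_zero hn.ne', smoothCut_of_not_mem h]; simp

/-- `|g̃(n) n^{-(σ+it)}| ≤ smoothWeight N σ n` for `1`-bounded `g`. [folklore] -/
theorem norm_term_smoothCut_le_smoothWeight (hgb : ∀ n, ‖g n‖ ≤ 1) (σ : ℝ) (t : ℝ) (n : ℕ) :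
    ‖LSeries.term (smoothCut g N) (σ + t * I) n‖ ≤ smoothWeight N σ n := by
  rcases Nat.eq_zero_or_pos n with rfl | hn
  · simp only [LSeries.term_zero, norm_zero]; exact smoothWeight_nonneg σ 0
  · unfold smoothWeight
    rw [LSeries.term_of_ne_zero hn.ne', norm_div, Complex.norm_natCast_cpow_of_pos hn]
    simp only [Complex.add_re, Complex.ofReal_re, Complex.mul_re, Complex.I_re, mul_zero,
      Complex.ofReal_im, Complex.I_im, mul_one, sub_self, add_zero]
    by_cases h : n ∈ Nat.smoothNumbers (N + 1)
    · rw [if_pos h, div_eq_mul_inv]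
      refine mul_le_of_le_one_left (by positivity) ?_
      rw [smoothCut_of_mem h]; exact hgb n
    · rw [if_neg h, smoothCut_of_not_mem h, norm_zero, zero_div]

/-- `∑_{n smooth} n^{-σ} = ‖Z(σ)‖ ≤ exp(∑_{p ≤ N} p^{-σ} + 1)` for `σ ≥ 1`: summability and bound. [folklore] -/
theorem summable_smoothWeight {σ : ℝ} (hσ : 0 < σ) : Summable (smoothWeight N σ) := by
  have hg : ∀ m n : ℕ, (fun _ : ℕ => (1 : ℂ)) (m * n) = (fun _ : ℕ => (1 : ℂ)) m * (fun _ : ℕ => (1 : ℂ)) n :=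
    fun _ _ => by simp
  have hg1 : (fun _ : ℕ => (1 : ℂ)) 1 = 1 := rfl
  have hgb : ∀ n : ℕ, ‖(fun _ : ℕ => (1 : ℂ)) n‖ ≤ 1 := fun _ => by simp
  have h := (LSeriesSummable_smoothCut (N := N) hg hg1 hgb (s := (σ : ℂ)) (by simpa using hσ)).norm
  refine h.congr fun n => ?_
  rw [term_smoothCut_one_eq, Complex.norm_real, Real.norm_of_nonneg (smoothWeight_nonneg σ n)]

/-- `∑ smoothWeight N σ n ≤ exp(∑_{p ≤ N} p^{-σ} + 1)` for `σ ≥ 1` (Euler product of the majorant). [folklore] -/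
theorem tsum_smoothWeight_le {σ : ℝ} (hσ : 1 ≤ σ) :
    ∑' n, smoothWeight N σ n ≤ Real.exp (∑ p ∈ Nat.primesBelow (N + 1), ((p : ℝ) ^ σ)⁻¹ + 1) := by
  have hg : ∀ m n : ℕ, (fun _ : ℕ => (1 : ℂ)) (m * n) = (fun _ : ℕ => (1 : ℂ)) m * (fun _ : ℕ => (1 : ℂ)) n :=
    fun _ _ => by simp
  have hg1 : (fun _ : ℕ => (1 : ℂ)) 1 = 1 := rfl
  have hgb : ∀ n : ℕ, ‖(fun _ : ℕ => (1 : ℂ)) n‖ ≤ 1 := fun _ => by simp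
  have h := norm_LSeries_smoothCut_le (N := N) hg hg1 hgb (s := (σ : ℂ)) (by simpa using hσ)
  have heq : LSeries (smoothCut (fun _ => (1 : ℂ)) N) (σ : ℂ) = ((∑' n, smoothWeight N σ n : ℝ) : ℂ) := by
    rw [LSeries, Complex.ofReal_tsum]
    exact tsum_congr fun n => term_smoothCut_one_eq σ n
  rw [heq, Complex.norm_real, Real.norm_of_nonneg (tsum_nonneg (smoothWeight_nonneg σ))] at h
  refine h.trans (le_of_eq ?_)
  congr 2
  refine Finset.sum_congr rfl fun p hp => ?_
  rw [Nat.mem_primesBelow] at hp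
  rw [one_mul, show (p : ℂ) = ((p : ℝ) : ℂ) by simp, ← Complex.ofReal_neg,
    ← Complex.ofReal_cpow (Nat.cast_nonneg p), Complex.ofReal_re, Real.rpow_neg (Nat.cast_nonneg p)]

/-- `∑ |g̃(n)| n^{-1} ≤ e⁵ log x` (`x ≥ 3`). [folklore] -/
theorem tsum_norm_term_one_le (hgb : ∀ n, ‖g n‖ ≤ 1) (hx : 3 ≤ x) :
    Summable (fun n => ‖smoothCut g ⌊x⌋₊ n‖ / (n : ℝ) ^ (1 : ℝ)) ∧
      ∑' n, ‖smoothCut g ⌊x⌋₊ n‖ / (n : ℝ) ^ (1 : ℝ) ≤ Real.exp 5 * Real.log x := by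
  have hL : 0 < Real.log x := Real.log_pos (by linarith)
  have hle : ∀ n, ‖smoothCut g ⌊x⌋₊ n‖ / (n : ℝ) ^ (1 : ℝ) ≤ smoothWeight ⌊x⌋₊ 1 n := by
    intro n
    have := norm_term_smoothCut_le_smoothWeight (N := ⌊x⌋₊) hgb 1 0 n
    rcases Nat.eq_zero_or_pos n with rfl | hn
    · simp [smoothCut_zero] at this ⊢; exact this
    · rw [LSeries.term_of_ne_zero hn.ne', norm_div, Complex.norm_natCast_cpow_of_pos hn] at this
      simpa using this
  have hsum : Summable (fun n => ‖smoothCut g ⌊x⌋₊ n‖ / (n : ℝ) ^ (1 : ℝ)) :=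
    Summable.of_nonneg_of_le (fun n => by positivity) hle (summable_smoothWeight one_pos)
  refine ⟨hsum, ?_⟩
  calc ∑' n, ‖smoothCut g ⌊x⌋₊ n‖ / (n : ℝ) ^ (1 : ℝ) ≤ ∑' n, smoothWeight ⌊x⌋₊ 1 n :=
        Summable.tsum_le_tsum hle hsum (summable_smoothWeight one_pos)
    _ ≤ Real.exp (∑ p ∈ Nat.primesBelow (⌊x⌋₊ + 1), ((p : ℝ) ^ (1 : ℝ))⁻¹ + 1) := tsum_smoothWeight_le le_rfl
    _ ≤ Real.exp ((Real.log (Real.log x) + 4) + 1) := by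
        apply Real.exp_le_exp.mpr
        have := sum_primesLE_inv_le hx
        rw [show Nat.primesBelow (⌊x⌋₊ + 1) = Nat.primesLE ⌊x⌋₊ from rfl]
        simp only [Real.rpow_one, ← one_div]
        linarith
    _ = Real.exp 5 * Real.log x := by
        rw [show Real.log (Real.log x) + 4 + 1 = 5 + Real.log (Real.log x) by ring, Real.exp_add, Real.exp_log hL]

/-- `∑_{n smooth} n^{-1-α} ≤ e^{10}/α` (`0 < α ≤ 1`). [folklore] -/
theorem tsum_smoothWeight_one_add_le {α : ℝ} (hα : 0 < α) (hα1 : α ≤ 1) :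
    ∑' n, smoothWeight N (1 + α) n ≤ Real.exp 10 * (1 / α) := by
  refine (tsum_smoothWeight_le (by linarith)).trans ?_
  have h := sum_primesLE_rpow_le hα hα1 N
  calc Real.exp (∑ p ∈ Nat.primesBelow (N + 1), ((p : ℝ) ^ (1 + α))⁻¹ + 1)
      ≤ Real.exp ((Real.log (1 / α) + 9) + 1) := by
        apply Real.exp_le_exp.mpr
        rw [show Nat.primesBelow (N + 1) = Nat.primesLE N from rfl]
        have : ∑ p ∈ Nat.primesLE N, ((p : ℝ) ^ (1 + α))⁻¹ = ∑ p ∈ Nat.primesLE N, (p : ℝ) ^ (-(1 + α)) :=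
          Finset.sum_congr rfl fun p _ => by rw [Real.rpow_neg (Nat.cast_nonneg p)]
        linarith
    _ = Real.exp 10 * (1 / α) := by
        rw [show Real.log (1 / α) + 9 + 1 = 10 + Real.log (1 / α) by ring, Real.exp_add, Real.exp_log (by positivity)]


/-! ### `D = P · G`: the logarithmically weighted series -/

/-- `g̃(n) log n`. [folklore] -/
def mulLog (g : ℕ → ℂ) (N : ℕ) : ℕ → ℂ := fun n => smoothCut g N n * (Real.log n : ℂ)

/-- `g̃(n) Λ(n)`. [folklore] -/
def mulVM (g : ℕ → ℂ) (N : ℕ) : ℕ → ℂ := fun n => smoothCut g N n * (ArithmeticFunction.vonMangoldt n : ℂ)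

/-- `(g̃ log)(0) = 0`. [folklore] -/
theorem mulLog_zero : mulLog g N 0 = 0 := by simp [mulLog, smoothCut_zero]

/-- `(g̃ Λ)(0) = 0`. [folklore] -/
theorem mulVM_zero : mulVM g N 0 = 0 := by simp [mulVM, smoothCut_zero]

/-- `|g̃(n) log n| ≤ log n`. [folklore] -/
theorem norm_mulLog_le (hgb : ∀ n, ‖g n‖ ≤ 1) (n : ℕ) : ‖mulLog g N n‖ ≤ Real.log n := by
  rcases Nat.eq_zero_or_pos n with rfl | hn
  · simp [mulLog_zero]
  · unfold mulLog
    rw [norm_mul, Complex.norm_real, Real.norm_of_nonneg (Real.log_nonneg (by exact_mod_cast hn))]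
    exact mul_le_of_le_one_left (Real.log_nonneg (by exact_mod_cast hn)) (norm_smoothCut_le hgb n)

/-- `|g̃(n) Λ(n)| ≤ Λ(n)`. [folklore] -/
theorem norm_mulVM_le (hgb : ∀ n, ‖g n‖ ≤ 1) (n : ℕ) :
    ‖mulVM g N n‖ ≤ ArithmeticFunction.vonMangoldt n := by
  unfold mulVM
  rw [norm_mul, Complex.norm_real, Real.norm_of_nonneg ArithmeticFunction.vonMangoldt_nonneg]
  exact mul_le_of_le_one_left ArithmeticFunction.vonMangoldt_nonneg (norm_smoothCut_le hgb n)

/-- The Dirichlet-ring identity `(g̃Λ) ⋆ g̃ = g̃ · log` (complete multiplicativity and `Λ ⋆ 1 = log`).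
[folklore] -/
theorem convolution_mulVM_smoothCut (hg : ∀ m n, g (m * n) = g m * g n) :
    LSeries.convolution (mulVM g N) (smoothCut g N) = mulLog g N := by
  funext n
  rw [LSeries.convolution_def]
  simp only [mulVM, mulLog]
  rw [Nat.sum_divisorsAntidiagonal (f := fun a b => smoothCut g N a * (ArithmeticFunction.vonMangoldt a : ℂ) *
    smoothCut g N b)]
  have h : ∀ d ∈ n.divisors, smoothCut g N d * (ArithmeticFunction.vonMangoldt d : ℂ) * smoothCut g N (n / d) =
      smoothCut g N n * (ArithmeticFunction.vonMangoldt d : ℂ) := by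
    intro d hd
    have hdn : d * (n / d) = n := Nat.mul_div_cancel' (Nat.dvd_of_mem_divisors hd)
    calc smoothCut g N d * (ArithmeticFunction.vonMangoldt d : ℂ) * smoothCut g N (n / d)
        = (smoothCut g N d * smoothCut g N (n / d)) * (ArithmeticFunction.vonMangoldt d : ℂ) := by ring
      _ = smoothCut g N n * (ArithmeticFunction.vonMangoldt d : ℂ) := by rw [← smoothCut_mul hg, hdn]
  rw [Finset.sum_congr rfl h, ← Finset.mul_sum, ← Complex.ofReal_sum, ArithmeticFunction.vonMangoldt_sum]

/-- The series of `g̃ log` converges absolutely for `Re s > 1`. [folklore] -/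
theorem LSeriesSummable_mulLog (hgb : ∀ n, ‖g n‖ ≤ 1) {s : ℂ} (hs : 1 < s.re) :
    LSeriesSummable (mulLog g N) s := by
  set ε : ℝ := (s.re - 1) / 2 with hε
  have hε0 : 0 < ε := by simp only [hε]; linarith
  refine LSeriesSummable_of_le_const_mul_rpow (x := 1 + ε) (by simp only [hε]; linarith) ⟨1 / ε, fun n hn => ?_⟩
  refine (norm_mulLog_le hgb n).trans ?_
  have := Real.log_le_rpow_div (Nat.cast_nonneg n) hε0
  rw [show 1 + ε - 1 = ε by ring, div_mul_eq_mul_div, one_mul]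
  exact this

/-- The series of `g̃ Λ` converges absolutely for `Re s > 1`. [folklore] -/
theorem LSeriesSummable_mulVM (hgb : ∀ n, ‖g n‖ ≤ 1) {s : ℂ} (hs : 1 < s.re) :
    LSeriesSummable (mulVM g N) s := by
  have h := (LSeriesSummable_mulLog (g := g) (N := N) hgb hs).norm
  refine Summable.of_norm_bounded h (fun n => ?_)
  rcases Nat.eq_zero_or_pos n with rfl | hn
  · simp
  · rw [LSeries.term_of_ne_zero hn.ne', LSeries.term_of_ne_zero hn.ne', norm_div, norm_div]
    gcongr
    unfold mulVM mulLog
    rw [norm_mul, norm_mul, Complex.norm_real, Complex.norm_real,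
      Real.norm_of_nonneg ArithmeticFunction.vonMangoldt_nonneg,
      Real.norm_of_nonneg (Real.log_nonneg (by exact_mod_cast hn))]
    gcongr
    exact ArithmeticFunction.vonMangoldt_le_log

/-- **`D = P · G`** on `Re s > 1`: `∑ g̃(n) log n · n^{-s} = (∑ g̃(n)Λ(n) n^{-s}) (∑ g̃(n) n^{-s})`. [folklore] -/
theorem LSeries_mulLog_eq (hg : ∀ m n, g (m * n) = g m * g n) (hg1 : g 1 = 1)
    (hgb : ∀ n, ‖g n‖ ≤ 1) {s : ℂ} (hs : 1 < s.re) :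
    LSeries (mulLog g N) s = LSeries (mulVM g N) s * LSeries (smoothCut g N) s := by
  rw [← convolution_mulVM_smoothCut hg]
  exact LSeries_convolution' (LSeriesSummable_mulVM hgb hs) (LSeriesSummable_smoothCut hg hg1 hgb (by linarith))

/-! ### The coefficients of `D` on `Re s = 1 + α`: Rankin's trick -/

/-- `log n ≤ (2/α) n^{α/2}`. [folklore] -/
theorem log_le_rpow_half {α : ℝ} (hα : 0 < α) (n : ℕ) : Real.log n ≤ 2 / α * (n : ℝ) ^ (α / 2) := by
  have := Real.log_le_rpow_div (Nat.cast_nonneg n) (by positivity : 0 < α / 2)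
  rw [div_div_eq_mul_div] at this
  calc Real.log n ≤ (n : ℝ) ^ (α / 2) * 2 / α := this
    _ = 2 / α * (n : ℝ) ^ (α / 2) := by ring

/-- The `ℓ¹`-norm condition and the weighted `ℓ²` bound for `c_n = g̃(n) log n / n^{1+α}`:
`∑ n |c_n|² ≤ 4 e^{10}/α³`. [folklore] -/
theorem tsum_mul_norm_term_mulLog_sq_le (hgb : ∀ n, ‖g n‖ ≤ 1) {α : ℝ} (hα : 0 < α) (hα1 : α ≤ 1) :
    Summable (fun n : ℕ => (n : ℝ) * ‖LSeries.term (mulLog g N) (1 + α) n‖ ^ 2) ∧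
      ∑' n : ℕ, (n : ℝ) * ‖LSeries.term (mulLog g N) (1 + α) n‖ ^ 2 ≤ 4 * Real.exp 10 / α ^ 3 := by
  -- termwise: `n |c_n|² ≤ (4/α²) smoothWeight (1+α) n`
  have hle : ∀ n : ℕ, (n : ℝ) * ‖LSeries.term (mulLog g N) (1 + α) n‖ ^ 2 ≤
      4 / α ^ 2 * smoothWeight N (1 + α) n := by
    intro n
    rcases Nat.eq_zero_or_pos n with rfl | hn
    · simp only [Nat.cast_zero, zero_mul]
      exact mul_nonneg (by positivity) (smoothWeight_nonneg _ _)
    · have hn0 : (0 : ℝ) < n := by exact_mod_cast hn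
      rw [show ((1 : ℂ) + α) = (((1 + α : ℝ)) : ℂ) by push_cast; ring, LSeries.term_of_ne_zero hn.ne', norm_div,
        show (n : ℂ) = ((n : ℝ) : ℂ) by simp, ← Complex.ofReal_cpow (Nat.cast_nonneg n), Complex.norm_real,
        Real.norm_of_nonneg (by positivity)]
      unfold smoothWeight mulLog
      by_cases hs : n ∈ Nat.smoothNumbers (N + 1)
      · rw [if_pos hs, norm_mul, Complex.norm_real, Real.norm_of_nonneg (Real.log_nonneg (by exact_mod_cast hn))]
        have h1 : ‖smoothCut g N n‖ ≤ 1 := norm_smoothCut_le hgb n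
        have h2 : Real.log n ≤ 2 / α * (n : ℝ) ^ (α / 2) := log_le_rpow_half hα n
        have h3 : 0 ≤ Real.log n := Real.log_nonneg (by exact_mod_cast hn)
        have h4 : (‖smoothCut g N n‖ * Real.log n) ^ 2 ≤ (2 / α * (n : ℝ) ^ (α / 2)) ^ 2 := by
          apply pow_le_pow_left₀ (by positivity)
          calc ‖smoothCut g N n‖ * Real.log n ≤ 1 * Real.log n := by gcongr
            _ ≤ _ := by rw [one_mul]; exact h2
        have hpow : ((n : ℝ) ^ (α / 2)) ^ 2 = (n : ℝ) ^ α := by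
          rw [← Real.rpow_natCast, ← Real.rpow_mul hn0.le]; norm_num
        have hsplit : (n : ℝ) ^ (1 + α) = n * (n : ℝ) ^ α := by
          rw [Real.rpow_add hn0, Real.rpow_one]
        calc (n : ℝ) * ((‖smoothCut g N n‖ * Real.log n) / (n : ℝ) ^ (1 + α)) ^ 2
            = (n : ℝ) * ((‖smoothCut g N n‖ * Real.log n) ^ 2 / ((n : ℝ) ^ (1 + α)) ^ 2) := by rw [div_pow]
          _ ≤ (n : ℝ) * ((2 / α * (n : ℝ) ^ (α / 2)) ^ 2 / ((n : ℝ) ^ (1 + α)) ^ 2) :=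
              mul_le_mul_of_nonneg_left (div_le_div_of_nonneg_right h4 (by positivity)) (by positivity)
          _ = 4 / α ^ 2 * ((n : ℝ) ^ (1 + α))⁻¹ := by
              rw [mul_pow, hpow, hsplit]
              field_simp
              ring
      · rw [if_neg hs, smoothCut_of_not_mem hs]; simp
  have hsw := summable_smoothWeight (N := N) (σ := 1 + α) (by linarith)
  have hsum : Summable (fun n : ℕ => (n : ℝ) * ‖LSeries.term (mulLog g N) (1 + α) n‖ ^ 2) :=
    Summable.of_nonneg_of_le (fun n => by positivity) hle (hsw.mul_left _)
  refine ⟨hsum, ?_⟩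
  calc ∑' n : ℕ, (n : ℝ) * ‖LSeries.term (mulLog g N) (1 + α) n‖ ^ 2
      ≤ ∑' n, 4 / α ^ 2 * smoothWeight N (1 + α) n := Summable.tsum_le_tsum hle hsum (hsw.mul_left _)
    _ = 4 / α ^ 2 * ∑' n, smoothWeight N (1 + α) n := tsum_mul_left
    _ ≤ 4 / α ^ 2 * (Real.exp 10 * (1 / α)) := by
        gcongr; exact tsum_smoothWeight_one_add_le hα hα1
    _ = 4 * Real.exp 10 / α ^ 3 := by field_simp

/-! ### `∑_p 1/(p log p)` and the upper bound `M ≤ log log x + O(1)` -/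

/-- `∑_{p ≤ M} 1/(p log p) ≤ 13` (dyadic blocks and Chebyshev's `ϑ(x) ≤ x log 4`). [folklore] -/
theorem sum_primesLE_inv_mul_log_le (M : ℕ) :
    ∑ p ∈ Nat.primesLE M, 1 / ((p : ℝ) * Real.log p) ≤ 13 := by
  have hlog2 : (0.69 : ℝ) < Real.log 2 := by have := Real.log_two_gt_d9; linarith
  have hlog2pos : 0 < Real.log 2 := by linarith
  set K := Nat.log 2 M with hK
  -- fibres of `p ↦ Nat.log 2 p`
  have hmaps : ∀ p ∈ Nat.primesLE M, Nat.log 2 p ∈ Finset.Icc 1 K := by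
    intro p hp
    rw [Nat.mem_primesLE] at hp
    rw [Finset.mem_Icc]
    refine ⟨?_, Nat.log_mono_right hp.1⟩
    exact Nat.le_log_of_pow_le (by norm_num) (by simpa using hp.2.two_le)
  rw [← Finset.sum_fiberwise_of_maps_to hmaps]
  -- each fibre
  have hfib : ∀ j ∈ Finset.Icc 1 K,
      ∑ p ∈ (Nat.primesLE M).filter (fun p => Nat.log 2 p = j), 1 / ((p : ℝ) * Real.log p) ≤ 6 / (j : ℝ) ^ 2 := by
    intro j hj
    rw [Finset.mem_Icc] at hj
    have hj0 : (0 : ℝ) < j := by exact_mod_cast hj.1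
    have hjl : 0 < (j : ℝ) * Real.log 2 := by positivity
    -- termwise: `1/(p log p) ≤ log p / (2^j (j log 2)²)`
    have hterm : ∀ p ∈ (Nat.primesLE M).filter (fun p => Nat.log 2 p = j),
        1 / ((p : ℝ) * Real.log p) ≤ Real.log p / ((2 : ℝ) ^ j * ((j : ℝ) * Real.log 2) ^ 2) := by
      intro p hp
      simp only [Finset.mem_filter, Nat.mem_primesLE] at hp
      have hp2 := hp.1.2.two_le
      have hp0 : (0 : ℝ) < p := by exact_mod_cast hp.1.2.pos
      have hpow : (2 : ℝ) ^ j ≤ p := by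
        have := Nat.pow_log_le_self 2 (show p ≠ 0 by omega)
        rw [hp.2] at this
        exact_mod_cast this
      have hlogp : (j : ℝ) * Real.log 2 ≤ Real.log p := by
        rw [← Real.log_pow]
        exact Real.log_le_log (by positivity) hpow
      have hlogp0 : 0 < Real.log p := hjl.trans_le hlogp
      rw [div_le_div_iff₀ (by positivity) (by positivity), one_mul]
      calc (2 : ℝ) ^ j * ((j : ℝ) * Real.log 2) ^ 2 ≤ p * (Real.log p) ^ 2 := by
            gcongr
        _ = Real.log p * (p * Real.log p) := by ring
    -- sum of `log p` over the fibre is at most `ϑ(2^{j+1}) ≤ log 4 · 2^{j+1}`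
    have hθ : ∑ p ∈ (Nat.primesLE M).filter (fun p => Nat.log 2 p = j), Real.log p ≤
        Real.log 4 * (2 : ℝ) ^ (j + 1) := by
      have hsub : (Nat.primesLE M).filter (fun p => Nat.log 2 p = j) ⊆ Nat.primesLE (2 ^ (j + 1)) := by
        intro p hp
        simp only [Finset.mem_filter, Nat.mem_primesLE] at hp ⊢
        refine ⟨?_, hp.1.2⟩
        have := Nat.lt_pow_succ_log_self (b := 2) (by norm_num) p
        rw [hp.2] at this
        exact this.le
      calc ∑ p ∈ (Nat.primesLE M).filter (fun p => Nat.log 2 p = j), Real.log p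
          ≤ ∑ p ∈ Nat.primesLE (2 ^ (j + 1)), Real.log p :=
            Finset.sum_le_sum_of_subset_of_nonneg hsub fun p hp' _ => Real.log_nonneg (by
              rw [Nat.mem_primesLE] at hp'; exact_mod_cast hp'.2.one_lt.le)
        _ = Chebyshev.theta ((2 ^ (j + 1) : ℕ) : ℝ) := (Chebyshev.theta_eq_sum_primesLE_log _).symm
        _ ≤ Real.log 4 * ((2 ^ (j + 1) : ℕ) : ℝ) := Chebyshev.theta_le_log4_mul_x (by positivity)
        _ = Real.log 4 * (2 : ℝ) ^ (j + 1) := by push_cast; ring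
    have hlog4 : Real.log 4 = 2 * Real.log 2 := by
      rw [show (4:ℝ) = 2^2 by norm_num, Real.log_pow]; ring
    calc ∑ p ∈ (Nat.primesLE M).filter (fun p => Nat.log 2 p = j), 1 / ((p : ℝ) * Real.log p)
        ≤ ∑ p ∈ (Nat.primesLE M).filter (fun p => Nat.log 2 p = j),
            Real.log p / ((2 : ℝ) ^ j * ((j : ℝ) * Real.log 2) ^ 2) := Finset.sum_le_sum hterm
      _ = (∑ p ∈ (Nat.primesLE M).filter (fun p => Nat.log 2 p = j), Real.log p) /
            ((2 : ℝ) ^ j * ((j : ℝ) * Real.log 2) ^ 2) := by rw [Finset.sum_div]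
      _ ≤ (Real.log 4 * (2 : ℝ) ^ (j + 1)) / ((2 : ℝ) ^ j * ((j : ℝ) * Real.log 2) ^ 2) := by
            gcongr
      _ = 4 / Real.log 2 / (j : ℝ) ^ 2 := by
            rw [hlog4, pow_succ]; field_simp; ring
      _ ≤ 6 / (j : ℝ) ^ 2 := by
            gcongr
            rw [div_le_iff₀ hlog2pos]; nlinarith
  refine (Finset.sum_le_sum hfib).trans ?_
  -- `∑_{j=1}^{K} 6/j² ≤ 12`
  have hsq : ∑ j ∈ Finset.Icc 1 K, 6 / (j : ℝ) ^ 2 ≤ 12 := by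
    rcases Nat.eq_zero_or_pos K with hK0 | hK1
    · rw [hK0]; simp
    · rw [Finset.Icc_eq_cons_Ioc hK1, Finset.sum_cons]
      have h1 : ∑ j ∈ Finset.Ioc 1 K, 6 / (j : ℝ) ^ 2 ≤ 6 := by
        calc ∑ j ∈ Finset.Ioc 1 K, 6 / (j : ℝ) ^ 2 = 6 * ∑ j ∈ Finset.Ioc 1 K, 1 / (j : ℝ) ^ 2 := by
              rw [Finset.mul_sum]
              exact Finset.sum_congr rfl fun j _ => by ring
          _ ≤ 6 * (1 / ((1 : ℕ) : ℝ)) := by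
              gcongr
              exact Literature.NumberTheory.LFunctions.AFE.sum_Ioc_inv_sq_le le_rfl K
          _ = 6 := by norm_num
      norm_num at h1 ⊢
      linarith
  linarith

/-- `conj(p^{it}) = p^{-it}` for a natural number `p > 0`. [folklore] -/
theorem conj_natCast_cpow_mul_I (p : ℕ) (t : ℝ) :
    conj ((p : ℂ) ^ ((t : ℂ) * I)) = (p : ℂ) ^ (-((t : ℂ) * I)) := by
  have harg : ((p : ℂ)).arg ≠ Real.pi := by
    rw [Complex.natCast_arg]; exact Real.pi_ne_zero.symm
  have h1 : conj (-((t : ℂ) * I)) = (t : ℂ) * I := by simp [Complex.conj_ofReal]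
  have h2 := Complex.cpow_conj (p : ℂ) (-((t : ℂ) * I)) harg
  rw [h1, Complex.conj_natCast] at h2
  rw [h2, Complex.conj_conj]

/-- `|∫_0^1 Re(c · conj(p^{it})) dt| ≤ 2‖c‖/log p` for `p ≥ 2`. [folklore] -/
theorem abs_integral_re_mul_conj_cpow_le (c : ℂ) {p : ℕ} (hp : 2 ≤ p) :
    |∫ t in (0:ℝ)..1, (c * conj ((p : ℂ) ^ ((t : ℂ) * I))).re| ≤ 2 * ‖c‖ / Real.log p := by
  have hp0 : 0 < p := by omega
  have hpC : (p : ℂ) ≠ 0 := by exact_mod_cast hp0.ne'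
  have hlogp : 0 < Real.log p := Real.log_pos (by exact_mod_cast hp)
  set κ : ℂ := -((Real.log p : ℝ) : ℂ) * I with hκ
  have hκ0 : κ ≠ 0 := by
    simp only [hκ, neg_mul, ne_eq, neg_eq_zero, mul_eq_zero, Complex.ofReal_eq_zero, Complex.I_ne_zero,
      or_false]
    exact hlogp.ne'
  have hnormκ : ‖κ‖ = Real.log p := by
    simp only [hκ, neg_mul, norm_neg, norm_mul, Complex.norm_real, Complex.norm_I, mul_one,
      Real.norm_of_nonneg hlogp.le]
  -- the integrand as an exponential
  have hfun : (fun t : ℝ => c * conj ((p : ℂ) ^ ((t : ℂ) * I))) = fun t : ℝ => c * Complex.exp (κ * t) := by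
    funext t
    rw [conj_natCast_cpow_mul_I p, Complex.cpow_def_of_ne_zero hpC, ← Complex.ofReal_natCast,
      ← Complex.ofReal_log (Nat.cast_nonneg p)]
    congr 2
    simp only [hκ]; push_cast; ring
  have hcont : Continuous fun t : ℝ => c * Complex.exp (κ * t) := by fun_prop
  have hint : IntervalIntegrable (fun t : ℝ => c * conj ((p : ℂ) ^ ((t : ℂ) * I))) MeasureTheory.volume 0 1 := by
    rw [hfun]; exact hcont.intervalIntegrable _ _
  have hre : (∫ t in (0:ℝ)..1, (c * conj ((p : ℂ) ^ ((t : ℂ) * I))).re) =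
      (∫ t in (0:ℝ)..1, c * conj ((p : ℂ) ^ ((t : ℂ) * I))).re := by
    have hint' : MeasureTheory.IntegrableOn (fun t : ℝ => c * conj ((p : ℂ) ^ ((t : ℂ) * I))) (Set.Ioc 0 1) := by
      rw [hfun]; exact hcont.integrableOn_Ioc
    have h := integral_re (𝕜 := ℂ) hint'
    simp only [RCLike.re_to_complex] at h
    rw [intervalIntegral.integral_of_le zero_le_one, intervalIntegral.integral_of_le zero_le_one, h]
  rw [hre, hfun, intervalIntegral.integral_const_mul, integral_exp_mul_complex hκ0]
  refine (Complex.abs_re_le_norm _).trans ?_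
  rw [norm_mul, norm_div, hnormκ]
  have h2 : ‖Complex.exp (κ * (1:ℝ)) - Complex.exp (κ * (0:ℝ))‖ ≤ 2 := by
    refine (norm_sub_le _ _).trans ?_
    have e1 : ‖Complex.exp (κ * (1:ℝ))‖ = 1 := by
      rw [Complex.norm_exp]
      have : (κ * ((1:ℝ) : ℂ)).re = 0 := by
        rw [hκ]; simp [Complex.mul_re, Complex.log_im, Complex.natCast_arg]
      rw [this, Real.exp_zero]
    have e0 : ‖Complex.exp (κ * (0:ℝ))‖ = 1 := by simp
    linarith
  calc ‖c‖ * (‖Complex.exp (κ * (1:ℝ)) - Complex.exp (κ * (0:ℝ))‖ / Real.log p) ≤ ‖c‖ * (2 / Real.log p) := by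
        gcongr
    _ = 2 * ‖c‖ / Real.log p := by ring

/-- **`M(x, T) ≤ log log x + 30`**: some `t ∈ [0, 1]` has `𝔻(g, n^{it}; x)² ≤ log log x + 30`
(average over `t ∈ [0,1]`: `∫_0^1 𝔻(g,n^{it};x)² dt ≤ ∑_{p ≤ x} (1 + 2/log p)/p`). [folklore] -/
theorem exists_pretentiousDistSq_le (hgb : ∀ n, ‖g n‖ ≤ 1) (hx : 3 ≤ x) :
    ∃ t ∈ Set.Icc (0:ℝ) 1,
      Sieve.pretentiousDistSq g (fun n : ℕ => (n : ℂ) ^ ((t : ℂ) * I)) x ≤ Real.log (Real.log x) + 30 := by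
  set F : ℝ → ℝ := fun t => Sieve.pretentiousDistSq g (fun n : ℕ => (n : ℂ) ^ ((t : ℂ) * I)) x with hF
  set P := Nat.primesLE ⌊x⌋₊ with hP
  have hFdef : ∀ t, F t = ∑ p ∈ P, (1 - (g p * conj ((p : ℂ) ^ ((t : ℂ) * I))).re) / (p : ℝ) := fun t => rfl
  -- continuity
  have hterm_cont : ∀ p ∈ P, Continuous fun t : ℝ => (1 - (g p * conj ((p : ℂ) ^ ((t : ℂ) * I))).re) / (p : ℝ) := by
    intro p hpP
    have hp := hpP
    rw [hP, Nat.mem_primesLE] at hp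
    have hpC : (p : ℂ) ≠ 0 := by exact_mod_cast hp.2.pos.ne'
    have : (fun t : ℝ => (p : ℂ) ^ ((t : ℂ) * I)) = fun t : ℝ => Complex.exp (Complex.log p * ((t : ℂ) * I)) := by
      funext t; exact Complex.cpow_def_of_ne_zero hpC _
    refine Continuous.div_const (continuous_const.sub (Complex.continuous_re.comp
      (continuous_const.mul (Complex.continuous_conj.comp ?_)))) _
    rw [this]; fun_prop
  have hFcont : Continuous F := by
    have : F = fun t : ℝ => ∑ p ∈ P, (1 - (g p * conj ((p : ℂ) ^ ((t : ℂ) * I))).re) / (p : ℝ) := funext hFdef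
    rw [this]
    exact continuous_finsetSum _ hterm_cont
  -- the average
  set B : ℝ := Real.log (Real.log x) + 30 with hB
  have havg : ∫ t in (0:ℝ)..1, F t ≤ B := by
    have h1 : ∫ t in (0:ℝ)..1, F t = ∑ p ∈ P, ∫ t in (0:ℝ)..1, (1 - (g p * conj ((p : ℂ) ^ ((t : ℂ) * I))).re) / (p : ℝ) := by
      simp_rw [hFdef]
      exact intervalIntegral.integral_finsetSum fun p hp => (hterm_cont p hp).intervalIntegrable _ _
    rw [h1]
    have h2 : ∀ p ∈ P, ∫ t in (0:ℝ)..1, (1 - (g p * conj ((p : ℂ) ^ ((t : ℂ) * I))).re) / (p : ℝ) ≤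
        (1 + 2 / Real.log p) / p := by
      intro p hp
      rw [hP, Nat.mem_primesLE] at hp
      have hp0 : (0 : ℝ) < p := by exact_mod_cast hp.2.pos
      have hpC : (p : ℂ) ≠ 0 := by exact_mod_cast hp.2.pos.ne'
      have hcont' : Continuous fun t : ℝ => (g p * conj ((p : ℂ) ^ ((t : ℂ) * I))).re := by
        have : (fun t : ℝ => (p : ℂ) ^ ((t : ℂ) * I)) = fun t : ℝ => Complex.exp (Complex.log p * ((t : ℂ) * I)) := by
          funext t; exact Complex.cpow_def_of_ne_zero hpC _
        refine Complex.continuous_re.comp (continuous_const.mul (Complex.continuous_conj.comp ?_))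
        rw [this]; fun_prop
      rw [intervalIntegral.integral_div, intervalIntegral.integral_sub intervalIntegrable_const
        (hcont'.intervalIntegrable _ _), intervalIntegral.integral_const]
      simp only [sub_zero, smul_eq_mul, one_mul]
      have hb := abs_integral_re_mul_conj_cpow_le (g p) hp.2.two_le
      have hb' : -(∫ t in (0:ℝ)..1, (g p * conj ((p : ℂ) ^ ((t : ℂ) * I))).re) ≤ 2 / Real.log p := by
        have := neg_abs_le (∫ t in (0:ℝ)..1, (g p * conj ((p : ℂ) ^ ((t : ℂ) * I))).re)
        have hg1 : 2 * ‖g p‖ / Real.log p ≤ 2 / Real.log p := by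
          have hl : 0 < Real.log p := Real.log_pos (by exact_mod_cast hp.2.one_lt)
          rw [div_le_div_iff_of_pos_right hl]
          nlinarith [hgb p, norm_nonneg (g p)]
        linarith
      gcongr
      linarith
    refine (Finset.sum_le_sum h2).trans ?_
    have h3 : ∑ p ∈ P, (1 + 2 / Real.log p) / (p : ℝ) =
        ∑ p ∈ P, (1 : ℝ) / p + 2 * ∑ p ∈ P, 1 / ((p : ℝ) * Real.log p) := by
      rw [Finset.mul_sum, ← Finset.sum_add_distrib]
      refine Finset.sum_congr rfl fun p hp => ?_
      rw [hP, Nat.mem_primesLE] at hp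
      have hp0 : (0 : ℝ) < p := by exact_mod_cast hp.2.pos
      have hl : 0 < Real.log p := Real.log_pos (by exact_mod_cast hp.2.one_lt)
      field_simp
    rw [h3]
    have := sum_primesLE_inv_le hx
    have := sum_primesLE_inv_mul_log_le ⌊x⌋₊
    simp only [hB]
    linarith
  -- a point below the average
  by_contra hcon
  simp only [not_exists, not_and, not_le] at hcon
  have hlt : ∫ t in (0:ℝ)..1, (fun _ => B) t < ∫ t in (0:ℝ)..1, F t := by
    refine intervalIntegral.integral_lt_integral_of_continuousOn_of_le_of_exists_lt zero_lt_one
      continuousOn_const hFcont.continuousOn (fun t ht => (hcon t ⟨ht.1.le, ht.2⟩).le) ⟨0, ⟨le_rfl, zero_le_one⟩, ?_⟩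
    exact hcon 0 ⟨le_rfl, zero_le_one⟩
  rw [intervalIntegral.integral_const] at hlt
  simp at hlt
  linarith

end Halasz


end Literature.NumberTheory.LFunctions
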